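import Summits.Langlands.Langlands.Theorems.QuadraticWindowHostInducedRepAsaiFibreProducts
import Summits.Langlands.Langlands.Theorems.QuadraticWindowHostInducedRepMemberSatakeData

/-!
# The local Asai identity in a biquadratic tower, II: the induced side and the assembly —
helper file 5 for stub `stub_asaiPoleInduced` of line `one-transparent-pane`
(crux `Summit.Langlands.Langlands.Theses.QuadraticWindow.HostInducedRep`, item stmt-Langlands-10902)

LOG (worker `stub_asaiPoleInduced`).  FACT-FREE.  Setting of `AsaiLocalIdentity`: `F₀ ⊆ K ⊆ L`,
`[K:F₀] = [L:K] = 2` (involutions `cK`, `t`), `s₀ ∈ Gal(L/F₀)` an involution with `s₀|_K = cK`, and the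
two quadratic subextensions `F' = L^{s₀}`, `F = L^{s₀t₀}` (given abstractly with their involutions
`sF`, `θF`, `sF|^{F₀} = s₀`, `θF|^{F₀} = s₀ t₀`).  For a Satake family `A'` over `L` and a family `A`
over `K` INDUCED from it above `v` (`P_{A u} = ∏_{w|u} P_{A' w}(X^{f(w|u)})`, Arthur–Clozel (6.1)–(6.2),
the almost-everywhere content of `IsAutomorphicInductionAlong`; split/inert fibres read off the landed
`induced_split` / `induced_inert` of the sibling helper file `…MemberSatakeData`, and
`(s₀ • w) ∩ 𝓞 K = cK • (w ∩ 𝓞 K)` is the landed `under_smul_of_comm` of `…MemberSatakeKlein` — LANDING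
LOG (wave 3): de-duplicated accordingly; registered anchor `asaiLocalIdentityQ_anchor` at the end):

* `asaiLocalPolynomial_induced_of_none/of_t/of_s` — the unramified `(K/F₀, cK)`-Asai polynomial of `A`
  at the place of `K` above `v`, in the four positions of `D_{w₀}`;
* `local_factor_eq` — **the local identity**:
  `L_v(z, A, As^η_{K/F₀}) = ∏_{v'|v} L_{v'}(z, A', As^η_{L/F'}) · ∏_{v''|v} L_{v''}(z, A', As^η_{L/F})`
  for every place `v` of `F₀` unramified in `L` (with `K`, `F'`, `F` unramified above `v`), every sign
  `η` and every `z ∈ ℂ` — the Euler factor at `v` of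
  `As_{K/F₀}(Ind_{L/K} ρ) ≅ Ind_{F'/F₀} As_{L/F'}(ρ) ⊕ Ind_{F/F₀} As_{L/F}(ρ)`.  [folklore]
-/

set_option linter.dupNamespace false -- project-wide option (lakefile weak.linter.dupNamespace); `Summit.Langlands.Langlands` is the mandated namespace

open scoped Classical
open Literature.NumberTheory.Automorphic
open Summit.Langlands.Langlands.Theorems.HostInducedRep.Negative
open IsDedekindDomain NumberField Polynomial

namespace Summit.Langlands.Langlands.Theorems.HostInducedRep.OneTransparentPane

section Induced

variable {F₀ K L : Type} [Field F₀] [NumberField F₀] [Field K] [NumberField K] [Field L] [NumberField L]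
  [Algebra F₀ K] [Algebra K L] [Algebra F₀ L] [IsScalarTower F₀ K L]

omit [NumberField F₀] [NumberField K] [NumberField L] in
/-- **`s₀|_K = cK ≠ 1` puts `s₀` outside `Gal(L/K) = {1, t₀}`**: `s₀ ≠ 1`, `s₀ ≠ t₀`, `s₀ t₀ ≠ 1`.
[folklore] -/
theorem klein_of_restricts {cK : K ≃ₐ[F₀] K} (hcK : cK ≠ 1) (t : L ≃ₐ[K] L) {s₀ : L ≃ₐ[F₀] L}
    (hs₀K : ∀ x : K, s₀ (algebraMap K L x) = algebraMap K L (cK x)) :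
    s₀ ≠ 1 ∧ s₀ ≠ t.restrictScalars F₀ ∧ s₀ * t.restrictScalars F₀ ≠ 1 := by
  obtain ⟨x, hx⟩ : ∃ x : K, cK x ≠ x := by
    by_contra h
    push Not at h
    exact hcK (AlgEquiv.ext h)
  have hinj := (algebraMap K L).injective
  have key : s₀ (algebraMap K L x) ≠ algebraMap K L x := by
    rw [hs₀K]
    exact fun e => hx (hinj e)
  refine ⟨fun h => key (by rw [h]; rfl), fun h => key (by rw [h]; exact t.commutes x), fun h => key ?_⟩
  have := AlgEquiv.congr_fun h (algebraMap K L x)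
  rw [AlgEquiv.mul_apply, AlgEquiv.one_apply] at this
  change s₀ (t (algebraMap K L x)) = algebraMap K L x at this
  rwa [t.commutes x] at this

omit [NumberField F₀] [NumberField K] [NumberField L] in
/-- `s₀ • t • w₀ = w₀ ↔ t • w₀ = s₀ • w₀` for the involution `s₀`. [folklore] -/
theorem smul_smul_eq_iff₀ {t : L ≃ₐ[K] L} {s₀ : L ≃ₐ[F₀] L} (hss : s₀ * s₀ = 1)
    (w₀ : HeightOneSpectrum (𝓞 L)) : s₀ • t • w₀ = w₀ ↔ t • w₀ = s₀ • w₀ := by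
  rw [← HeightOneSpectrum.restrictScalars_smul (F := F₀) t]
  constructor
  · intro h
    calc t.restrictScalars F₀ • w₀ = (s₀ * s₀) • t.restrictScalars F₀ • w₀ := by rw [hss, one_smul]
      _ = s₀ • s₀ • t.restrictScalars F₀ • w₀ := mul_smul _ _ _
      _ = s₀ • w₀ := by rw [h]
  · intro h
    rw [h, smul_smul, hss, one_smul]

omit [NumberField F₀] [NumberField K] [NumberField L] in
/-- `s₀ • t • w₀ = t • w₀ ↔ s₀ • w₀ = w₀` when `s₀ t₀ = t₀ s₀`. [folklore] -/
theorem smul_smul_eq_smul_iff₀ {t : L ≃ₐ[K] L} {s₀ : L ≃ₐ[F₀] L}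
    (hcomm : s₀ * t.restrictScalars F₀ = t.restrictScalars F₀ * s₀) (w₀ : HeightOneSpectrum (𝓞 L)) :
    s₀ • t • w₀ = t • w₀ ↔ s₀ • w₀ = w₀ := by
  rw [← HeightOneSpectrum.restrictScalars_smul (F := F₀) t,
    show s₀ • t.restrictScalars F₀ • w₀ = t.restrictScalars F₀ • s₀ • w₀ by
      rw [smul_smul, smul_smul, hcomm], smul_left_cancel_iff]

omit [NumberField L] in
/-- The `(K/F₀, cK)`-Asai polynomial of `A` at the chosen place above `v` is the one at `w₀ ∩ 𝓞 K`.
[folklore] -/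
theorem asaiLocalPolynomial_placeAbove_eq (h2 : Module.finrank F₀ K = 2) {cK : K ≃ₐ[F₀] K} (hcK : cK ≠ 1)
    (A : SatakeFamily K) (η : ℤˣ) {w₀ : HeightOneSpectrum (𝓞 L)} {v : HeightOneSpectrum (𝓞 F₀)}
    (hw₀ : w₀.under (𝓞 F₀) = v) :
    asaiLocalPolynomial cK A η (placeAbove K v) = asaiLocalPolynomial cK A η (w₀.under (𝓞 K)) := by
  rw [← hw₀, ← under_under_place (F := K) w₀]
  exact asaiLocalPolynomial_placeAbove_under h2 hcK A η _

omit [NumberField F₀] [IsScalarTower F₀ K L] in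
/-- **`cK` fixes `w₀ ∩ K` iff `s₀ w₀ ∈ {w₀, t w₀}`** (`cK • (w₀ ∩ K) = (s₀ w₀) ∩ K`). [folklore] -/
theorem smul_under_eq_iff (h2K : Module.finrank K L = 2) {t : L ≃ₐ[K] L} (ht : t ≠ 1)
    {cK : K ≃ₐ[F₀] K} {s₀ : L ≃ₐ[F₀] L} (hs₀K : ∀ x : K, s₀ (algebraMap K L x) = algebraMap K L (cK x))
    (w₀ : HeightOneSpectrum (𝓞 L)) :
    cK • w₀.under (𝓞 K) = w₀.under (𝓞 K) ↔ s₀ • w₀ = w₀ ∨ s₀ • w₀ = t • w₀ := by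
  rw [← under_smul_of_comm hs₀K w₀]
  constructor
  · intro h
    exact HeightOneSpectrum.eq_or_eq_smul_of_under_eq h2K ht h
  · rintro (h | h)
    · rw [h]
    · rw [h, HeightOneSpectrum.under_algEquiv_smul]

omit [NumberField F₀] [NumberField K] [NumberField L] in
/-- `t` moves `s₀ w₀` as soon as it moves `w₀` (`t s₀ = s₀ t`). [folklore] -/
theorem smul_smul_ne_of_ne {t : L ≃ₐ[K] L} {s₀ : L ≃ₐ[F₀] L}
    (hcomm : t.restrictScalars F₀ * s₀ = s₀ * t.restrictScalars F₀) {w₀ : HeightOneSpectrum (𝓞 L)}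
    (htw : t • w₀ ≠ w₀) : t • s₀ • w₀ ≠ s₀ • w₀ := by
  intro h
  apply htw
  rw [← HeightOneSpectrum.restrictScalars_smul (F := F₀) t] at h ⊢
  rw [smul_smul, hcomm, ← smul_smul] at h
  exact smul_left_cancel _ h

omit [NumberField F₀] [NumberField K] [NumberField L] in
/-- … and fixes `s₀ w₀` as soon as it fixes `w₀`. [folklore] -/
theorem smul_smul_eq_of_eq {t : L ≃ₐ[K] L} {s₀ : L ≃ₐ[F₀] L}
    (hcomm : t.restrictScalars F₀ * s₀ = s₀ * t.restrictScalars F₀) {w₀ : HeightOneSpectrum (𝓞 L)}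
    (htw : t • w₀ = w₀) : t • s₀ • w₀ = s₀ • w₀ := by
  rw [← HeightOneSpectrum.restrictScalars_smul (F := F₀) t] at htw ⊢
  rw [smul_smul, hcomm, ← smul_smul, htw]

omit [NumberField F₀] [NumberField K] [NumberField L] in
/-- The Klein relations for `(t₀, s₀)` from `[L:K] = 2` and `s₀|_K = cK ≠ 1`. [folklore] -/
theorem klein_relations₀ (h4 : Module.finrank F₀ L = 4) (h2K : Module.finrank K L = 2)
    {cK : K ≃ₐ[F₀] K} (hcK : cK ≠ 1) {t : L ≃ₐ[K] L} (ht : t ≠ 1) {s₀ : L ≃ₐ[F₀] L}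
    (hs₀K : ∀ x : K, s₀ (algebraMap K L x) = algebraMap K L (cK x)) :
    t.restrictScalars F₀ ≠ 1 ∧ s₀ ≠ 1 ∧ s₀ ≠ t.restrictScalars F₀ ∧ s₀ * t.restrictScalars F₀ ≠ 1 ∧
      t.restrictScalars F₀ * t.restrictScalars F₀ = 1 ∧
        t.restrictScalars F₀ * s₀ = s₀ * t.restrictScalars F₀ := by
  obtain ⟨hs1, hst, hst1⟩ := klein_of_restricts hcK t hs₀K
  have ht₀ : t.restrictScalars F₀ ≠ 1 := fun h => ht ((restrictScalars_eq_one_iff t).mp h)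
  have htt : t.restrictScalars F₀ * t.restrictScalars F₀ = 1 := by
    rw [← AlgEquiv.restrictScalars_mul', AlgEquiv.mul_self_eq_one_of_finrank_eq_two h2K t]
    exact AlgEquiv.ext fun _ => rfl
  exact ⟨ht₀, hs1, hst, hst1, htt, mul_comm_of_four h4 ht₀ hs1 hst hst1 htt⟩

/-- **Position `D_{w₀} = 1`** (`v` totally split): the `(K/F₀)`-Asai polynomial of the induced family is
`det(1 - (A' w₀ ⊕ A' tw₀) ⊗ (A' s₀w₀ ⊕ A' ts₀w₀) X)`. [folklore] -/
theorem asaiLocalPolynomial_induced_of_none (h4 : Module.finrank F₀ L = 4) (h2 : Module.finrank F₀ K = 2)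
    (h2K : Module.finrank K L = 2) {cK : K ≃ₐ[F₀] K} (hcK : cK ≠ 1) {t : L ≃ₐ[K] L} (ht : t ≠ 1)
    {s₀ : L ≃ₐ[F₀] L} (hs₀K : ∀ x : K, s₀ (algebraMap K L x) = algebraMap K L (cK x)) (hss : s₀ * s₀ = 1)
    (A : SatakeFamily K) (A' : SatakeFamily L) (η : ℤˣ) {w₀ : HeightOneSpectrum (𝓞 L)}
    {v : HeightOneSpectrum (𝓞 F₀)} (hw₀ : w₀.under (𝓞 F₀) = v)
    (hA : ∀ u : HeightOneSpectrum (𝓞 K), u.under (𝓞 F₀) = v →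
      satakePolynomial (A u) = inducedSatakePolynomial u A')
    (htw : t • w₀ ≠ w₀) (hsw : s₀ • w₀ ≠ w₀) (hstw : s₀ • t • w₀ ≠ w₀) :
    asaiLocalPolynomial cK A η (placeAbove K v) =
      satakePairPolynomial (A' w₀ + A' (t • w₀)) (A' (s₀ • w₀) + A' (t • s₀ • w₀)) := by
  obtain ⟨-, -, -, -, -, hcomm⟩ := klein_relations₀ h4 h2K hcK ht hs₀K
  have hu₀ : (w₀.under (𝓞 K)).under (𝓞 F₀) = v := by rw [under_under_place, hw₀]
  have hsu₀ : ((s₀ • w₀).under (𝓞 K)).under (𝓞 F₀) = v := by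
    rw [under_under_place, HeightOneSpectrum.under_algEquiv_smul, hw₀]
  have hne : cK • w₀.under (𝓞 K) ≠ w₀.under (𝓞 K) := by
    rw [Ne, smul_under_eq_iff h2K ht hs₀K]
    rintro (h | h)
    · exact hsw h
    · exact hstw ((smul_smul_eq_iff₀ hss w₀).mpr h.symm)
  rw [asaiLocalPolynomial_placeAbove_eq h2 hcK A η hw₀, asaiLocalPolynomial_of_smul_ne A η hne,
    ← under_smul_of_comm hs₀K w₀, (induced_split h2K ht rfl htw (hA _ hu₀)).2.2.2.2,
    (induced_split h2K ht rfl (smul_smul_ne_of_ne hcomm htw) (hA _ hsu₀)).2.2.2.2]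

/-- **Position `t₀ ∈ D_{w₀}`** (`v` split in `K`, inert above): the `(K/F₀)`-Asai polynomial of the
induced family is `det(1 - A' w₀ ⊗ A' (s₀w₀) X²)²` (square roots of the parameters, Arthur–Clozel (6.2)).
[folklore] -/
theorem asaiLocalPolynomial_induced_of_t (h4 : Module.finrank F₀ L = 4) (h2 : Module.finrank F₀ K = 2)
    (h2K : Module.finrank K L = 2) {cK : K ≃ₐ[F₀] K} (hcK : cK ≠ 1) {t : L ≃ₐ[K] L} (ht : t ≠ 1)
    {s₀ : L ≃ₐ[F₀] L} (hs₀K : ∀ x : K, s₀ (algebraMap K L x) = algebraMap K L (cK x)) (hss : s₀ * s₀ = 1)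
    (A : SatakeFamily K) (A' : SatakeFamily L) (η : ℤˣ) {w₀ : HeightOneSpectrum (𝓞 L)}
    {v : HeightOneSpectrum (𝓞 F₀)} (hw₀ : w₀.under (𝓞 F₀) = v)
    (hvL : Algebra.IsUnramifiedIn (𝓞 L) v.asIdeal)
    (hvKL : ∀ u : HeightOneSpectrum (𝓞 K), u.under (𝓞 F₀) = v → Algebra.IsUnramifiedIn (𝓞 L) u.asIdeal)
    (hA : ∀ u : HeightOneSpectrum (𝓞 K), u.under (𝓞 F₀) = v →
      satakePolynomial (A u) = inducedSatakePolynomial u A')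
    (htw : t • w₀ = w₀) :
    asaiLocalPolynomial cK A η (placeAbove K v) =
      ((satakePairPolynomial (A' w₀) (A' (s₀ • w₀))).comp (X ^ 2)) ^ 2 := by
  obtain ⟨ht₀, hs1, hst, hst1, htt, hcomm⟩ := klein_relations₀ h4 h2K hcK ht hs₀K
  have hexcl := not_smul_eq_and_smul_eq h4 ht₀ hs1 hst hst1 htt hss (w := w₀) (hw₀ ▸ hvL)
  rw [HeightOneSpectrum.restrictScalars_smul] at hexcl
  have hsw : s₀ • w₀ ≠ w₀ := fun h => hexcl ⟨htw, h⟩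
  have hu₀ : (w₀.under (𝓞 K)).under (𝓞 F₀) = v := by rw [under_under_place, hw₀]
  have hsu₀ : ((s₀ • w₀).under (𝓞 K)).under (𝓞 F₀) = v := by
    rw [under_under_place, HeightOneSpectrum.under_algEquiv_smul, hw₀]
  have hne : cK • w₀.under (𝓞 K) ≠ w₀.under (𝓞 K) := by
    rw [Ne, smul_under_eq_iff h2K ht hs₀K, htw]
    rintro (h | h) <;> exact hsw h
  rw [asaiLocalPolynomial_placeAbove_eq h2 hcK A η hw₀, asaiLocalPolynomial_of_smul_ne A η hne,
    ← under_smul_of_comm hs₀K w₀]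
  exact satakePairPolynomial_of_sq (induced_inert h2K ht rfl htw (hvKL _ hu₀) (hA _ hu₀)).2.2
    (induced_inert h2K ht rfl (smul_smul_eq_of_eq hcomm htw) (hvKL _ hsu₀) (hA _ hsu₀)).2.2

/-- **Positions `s₀ ∈ D_{w₀}` and `s₀t₀ ∈ D_{w₀}`** (`v` inert in `K`, split above): the `(K/F₀)`-Asai
polynomial of the induced family is `P^η(A' w₀ ⊕ A' (tw₀))`. [folklore] -/
theorem asaiLocalPolynomial_induced_of_s (h4 : Module.finrank F₀ L = 4) (h2 : Module.finrank F₀ K = 2)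
    (h2K : Module.finrank K L = 2) {cK : K ≃ₐ[F₀] K} (hcK : cK ≠ 1) {t : L ≃ₐ[K] L} (ht : t ≠ 1)
    {s₀ : L ≃ₐ[F₀] L} (hs₀K : ∀ x : K, s₀ (algebraMap K L x) = algebraMap K L (cK x)) (hss : s₀ * s₀ = 1)
    (A : SatakeFamily K) (A' : SatakeFamily L) (η : ℤˣ) {w₀ : HeightOneSpectrum (𝓞 L)}
    {v : HeightOneSpectrum (𝓞 F₀)} (hw₀ : w₀.under (𝓞 F₀) = v)
    (hvL : Algebra.IsUnramifiedIn (𝓞 L) v.asIdeal)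
    (hA : ∀ u : HeightOneSpectrum (𝓞 K), u.under (𝓞 F₀) = v →
      satakePolynomial (A u) = inducedSatakePolynomial u A')
    (hfix : s₀ • w₀ = w₀ ∨ s₀ • t • w₀ = w₀) :
    asaiLocalPolynomial cK A η (placeAbove K v) = asaiInertPolynomial η (A' w₀ + A' (t • w₀)) := by
  obtain ⟨ht₀, hs1, hst, hst1, htt, -⟩ := klein_relations₀ h4 h2K hcK ht hs₀K
  have hexcl := not_smul_eq_and_smul_eq h4 ht₀ hs1 hst hst1 htt hss (w := w₀) (hw₀ ▸ hvL)
  rw [HeightOneSpectrum.restrictScalars_smul] at hexcl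
  have htw : t • w₀ ≠ w₀ := by
    intro h
    rcases hfix with h' | h'
    · exact hexcl ⟨h, h'⟩
    · exact hexcl ⟨h, by rwa [h] at h'⟩
  have hu₀ : (w₀.under (𝓞 K)).under (𝓞 F₀) = v := by rw [under_under_place, hw₀]
  have heq : cK • w₀.under (𝓞 K) = w₀.under (𝓞 K) := by
    rw [smul_under_eq_iff h2K ht hs₀K]
    exact hfix.imp id fun h => ((smul_smul_eq_iff₀ hss w₀).mp h).symm
  rw [asaiLocalPolynomial_placeAbove_eq h2 hcK A η hw₀, asaiLocalPolynomial_of_smul_eq A η heq,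
    (induced_split h2K ht rfl htw (hA _ hu₀)).2.2.2.2]

end Induced

section Assembly

variable {F₀ K F' F L : Type} [Field F₀] [NumberField F₀] [Field K] [NumberField K]
  [Field F'] [NumberField F'] [Field F] [NumberField F] [Field L] [NumberField L]
  [Algebra F₀ K] [Algebra K L] [Algebra F₀ L] [IsScalarTower F₀ K L]
  [Algebra F₀ F'] [Algebra F' L] [IsScalarTower F₀ F' L]
  [Algebra F₀ F] [Algebra F L] [IsScalarTower F₀ F L]

/-- **The local Asai identity of the biquadratic tower.**  Let `v` be a place of `F₀` unramified in
`L`, with the places of `K`, `F'`, `F` above `v` unramified in `L`; `w₀ | v` a place of `L`; `A'` a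
Satake family over `L` and `A` a family over `K` induced from `A'` above `v`
(`P_{A u} = ∏_{w|u} P_{A' w}(X^{f(w|u)})`).  Then, for every sign `η` and every `z ∈ ℂ`
(`q^{-z}` at every place):
`L_v(z, A, As^η_{K/F₀}) = ∏_{v'|v} L_{v'}(z, A', As^η_{L/F'}) · ∏_{v''|v} L_{v''}(z, A', As^η_{L/F})`,
where `F' = L^{s₀}`, `F = L^{s₀t₀}` are given with their involutions `sF`, `θF` (`sF|^{F₀} = s₀`
restricts to `cK` on `K`, `θF|^{F₀} = s₀ t₀`).  Proof: by the position of `D_{w₀}` among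
`1, ⟨t₀⟩, ⟨s₀⟩, ⟨s₀t₀⟩` (`asaiLocalPolynomial_induced_of_*`, `tprod_fibre_of_*`) and the three
polynomial identities of `AsaiLocalInduced`.  This is the Euler factor at `v` of
`As^η_{K/F₀}(Ind_{L/K} ρ) ≅ Ind_{F'/F₀} As^η_{L/F'}(ρ) ⊕ Ind_{F/F₀} As^η_{L/F}(ρ)`. [folklore] -/
theorem local_factor_eq (h4 : Module.finrank F₀ L = 4) (h2 : Module.finrank F₀ K = 2)
    (h2K : Module.finrank K L = 2) (h2F' : Module.finrank F' L = 2) (h2F : Module.finrank F L = 2)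
    {cK : K ≃ₐ[F₀] K} (hcK : cK ≠ 1) {t : L ≃ₐ[K] L} (ht : t ≠ 1) {sF : L ≃ₐ[F'] L} (hsF : sF ≠ 1)
    {θF : L ≃ₐ[F] L} (hθF : θF ≠ 1)
    (hsK : ∀ x : K, sF.restrictScalars F₀ (algebraMap K L x) = algebraMap K L (cK x))
    (hθF₀ : θF.restrictScalars F₀ = sF.restrictScalars F₀ * t.restrictScalars F₀)
    {v : HeightOneSpectrum (𝓞 F₀)} {w₀ : HeightOneSpectrum (𝓞 L)} (hw₀ : w₀.under (𝓞 F₀) = v)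
    (hvL : Algebra.IsUnramifiedIn (𝓞 L) v.asIdeal)
    (hvKL : ∀ u : HeightOneSpectrum (𝓞 K), u.under (𝓞 F₀) = v → Algebra.IsUnramifiedIn (𝓞 L) u.asIdeal)
    (hvF' : ∀ v' : HeightOneSpectrum (𝓞 F'), v'.under (𝓞 F₀) = v → Algebra.IsUnramifiedIn (𝓞 L) v'.asIdeal)
    (hvF : ∀ v'' : HeightOneSpectrum (𝓞 F), v''.under (𝓞 F₀) = v → Algebra.IsUnramifiedIn (𝓞 L) v''.asIdeal)
    (A : SatakeFamily K) (A' : SatakeFamily L)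
    (hA : ∀ u : HeightOneSpectrum (𝓞 K), u.under (𝓞 F₀) = v →
      satakePolynomial (A u) = inducedSatakePolynomial u A')
    (η : ℤˣ) (z : ℂ) :
    ((asaiLocalPolynomial cK A η (placeAbove K v)).eval (((v.residueCard : ℕ) : ℂ) ^ (-z)))⁻¹ =
      (∏' v' : {v' : HeightOneSpectrum (𝓞 F') // v'.under (𝓞 F₀) = v},
          ((asaiLocalPolynomial sF A' η (placeAbove L v'.1)).eval (((v'.1.residueCard : ℕ) : ℂ) ^ (-z)))⁻¹) *
        ∏' v'' : {v'' : HeightOneSpectrum (𝓞 F) // v''.under (𝓞 F₀) = v},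
          ((asaiLocalPolynomial θF A' η (placeAbove L v''.1)).eval (((v''.1.residueCard : ℕ) : ℂ) ^ (-z)))⁻¹ := by
  -- notation and the Klein relations
  set s₀ := sF.restrictScalars F₀ with hs₀def
  have hss : s₀ * s₀ = 1 := by
    rw [hs₀def, ← AlgEquiv.restrictScalars_mul', AlgEquiv.mul_self_eq_one_of_finrank_eq_two h2F' sF]
    exact AlgEquiv.ext fun _ => rfl
  obtain ⟨ht₀, hs1, hst, hst1, htt, hcomm⟩ := klein_relations₀ h4 h2K hcK ht hsK
  -- Klein hypotheses for the pair `(t, sF)` and `(t, θF)`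
  have hst' : sF.restrictScalars F₀ ≠ t.restrictScalars F₀ := hst
  have hst1' : sF.restrictScalars F₀ * t.restrictScalars F₀ ≠ 1 := hst1
  have hθt : θF.restrictScalars F₀ ≠ t.restrictScalars F₀ := by
    rw [hθF₀]; intro h; exact hs1 (mul_eq_right.mp h)
  have hθt1 : θF.restrictScalars F₀ * t.restrictScalars F₀ ≠ 1 := by
    rw [hθF₀, mul_assoc, htt, mul_one]; exact hs1
  -- the actions of `sF`, `θF` in terms of `s₀`, `t`
  have hsFw : ∀ w : HeightOneSpectrum (𝓞 L), sF • w = s₀ • w := fun w => rfl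
  have hθFw : ∀ w : HeightOneSpectrum (𝓞 L), θF • w = s₀ • t • w := fun w => by
    rw [← HeightOneSpectrum.restrictScalars_smul (F := F₀) θF, hθF₀, mul_smul]; rfl
  have hexcl := not_smul_eq_and_smul_eq h4 ht₀ hs1 hst hst1 htt hss (w := w₀) (hw₀ ▸ hvL)
  rw [HeightOneSpectrum.restrictScalars_smul] at hexcl
  set X : ℂ := (((v.residueCard : ℕ) : ℂ)) ^ (-z) with hX
  by_cases htw : t • w₀ = w₀
  · -- position `t₀ ∈ D`: split in `K`, inert above
    have hsw : s₀ • w₀ ≠ w₀ := fun h => hexcl ⟨htw, h⟩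
    have htsw : t • s₀ • w₀ = s₀ • w₀ := smul_smul_eq_of_eq hcomm htw
    rw [asaiLocalPolynomial_induced_of_t h4 h2 h2K hcK ht hsK hss A A' η hw₀ hvL hvKL hA htw,
      tprod_fibre_of_one h4 h2K h2F' ht hsF hst' hst1' hw₀ hvL A' η z (by rwa [hsFw]) (Or.inl htw),
      tprod_fibre_of_one h4 h2K h2F ht hθF hθt hθt1 hw₀ hvL A' η z
        (by rw [hθFw, htw]; exact hsw) (Or.inl htw),
      hsFw, hθFw, htw, eval_pow, eval_comp_X_sq, sq, mul_inv]
  by_cases hsw : s₀ • w₀ = w₀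
  · -- position `s₀ ∈ D`: inert in `K`, `F'`-places inert, `F`-place split
    have hstw : s₀ • t • w₀ = t • w₀ := (smul_smul_eq_smul_iff₀ hcomm.symm w₀).mpr hsw
    rw [asaiLocalPolynomial_induced_of_s h4 h2 h2K hcK ht hsK hss A A' η hw₀ hvL hA (Or.inl hsw),
      tprod_fibre_of_fixed h4 h2K h2F' ht hsF hst' hst1' hw₀ hvL hvF' A' η z (by rwa [hsFw]),
      tprod_fibre_of_one h4 h2K h2F ht hθF hθt hθt1 hw₀ hvL A' η z
        (by rw [hθFw, hstw]; exact htw) (Or.inr (by rw [hθFw, htw', hsw])),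
      hθFw, hstw, asaiInertPolynomial_add, eval_mul, eval_mul, eval_comp_X_sq, mul_inv, mul_inv]
  · by_cases hstw : s₀ • t • w₀ = w₀
    · -- position `s₀t₀ ∈ D`: inert in `K`, `F'`-place split, `F`-places inert
      have hts : t • w₀ = s₀ • w₀ := (smul_smul_eq_iff₀ hss w₀).mp hstw
      rw [asaiLocalPolynomial_induced_of_s h4 h2 h2K hcK ht hsK hss A A' η hw₀ hvL hA (Or.inr hstw),
        tprod_fibre_of_one h4 h2K h2F' ht hsF hst' hst1' hw₀ hvL A' η z (by rwa [hsFw]) (Or.inr hstw),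
        tprod_fibre_of_fixed h4 h2K h2F ht hθF hθt hθt1 hw₀ hvL hvF A' η z (by rw [hθFw, hstw]),
        hsFw, ← hts, asaiInertPolynomial_add, eval_mul, eval_mul, eval_comp_X_sq, mul_inv, mul_inv]
      ring
    · -- position `D = 1`: totally split
      have htsw : t • s₀ • w₀ ≠ s₀ • w₀ := smul_smul_ne_of_ne hcomm htw
      have hθw : θF • w₀ ≠ w₀ := by rw [hθFw]; exact hstw
      have hθtw : θF • t • w₀ ≠ w₀ := by rwa [hθFw, htw']
      rw [asaiLocalPolynomial_induced_of_none h4 h2 h2K hcK ht hsK hss A A' η hw₀ hA htw hsw hstw,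
        tprod_fibre_of_none h4 h2K h2F' ht hsF hst' hst1' hw₀ hvL A' η z htw (by rwa [hsFw]) (by rwa [hsFw]),
        tprod_fibre_of_none h4 h2K h2F ht hθF hθt hθt1 hw₀ hvL A' η z htw hθw hθtw,
        hsFw, hsFw, hθFw, hθFw, htw', satakePairPolynomial_add_left, satakePairPolynomial_add_right,
        satakePairPolynomial_add_right, eval_mul, eval_mul, eval_mul,
        mul_inv, mul_inv, mul_inv,
        show t • s₀ • w₀ = s₀ • t • w₀ by
          rw [← HeightOneSpectrum.restrictScalars_smul (F := F₀) t, smul_smul, hcomm, mul_smul]; rfl]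
      ring
  where
  /-- `t² = 1` on places: `t • t • w = w`. [folklore] -/
  htw' : t • t • w₀ = w₀ := by
    rw [HeightOneSpectrum.smul_smul_of_mul_self_eq_one (AlgEquiv.mul_self_eq_one_of_finrank_eq_two h2K t)]

end Assembly

/-- **Registered anchor** of this helper file (stub registry of stmt-Langlands-10902, line
`one-transparent-pane`, chain `stub_asaiPoleInduced` 5/7): `s₀|_K = cK ≠ 1` puts `s₀` outside
`Gal(L/K) = {1, t₀}`, `klein_of_restricts`. [folklore] -/
theorem asaiLocalIdentityQ_anchor : ∀ (F₀ K L : Type) [Field F₀] [Field K] [Field L] [Algebra F₀ K] [Algebra K L] [Algebra F₀ L] [IsScalarTower F₀ K L] (cK : K ≃ₐ[F₀] K), cK ≠ 1 → ∀ (t : L ≃ₐ[K] L) (s₀ : L ≃ₐ[F₀] L), (∀ x : K, s₀ (algebraMap K L x) = algebraMap K L (cK x)) → s₀ ≠ 1 ∧ s₀ ≠ AlgEquiv.restrictScalars F₀ t ∧ s₀ * AlgEquiv.restrictScalars F₀ t ≠ 1 :=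
  fun _ _ _ _ _ _ _ _ _ _ _ hcK t _ hs₀K => klein_of_restricts hcK t hs₀K

end Summit.Langlands.Langlands.Theorems.HostInducedRep.OneTransparentPane
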